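import Summits.RiemannHypothesis.RiemannHypothesis.Theorems.HandoffTranslatePair
import Summits.RiemannHypothesis.RiemannHypothesis.Theorems.HandoffCapacity
import Literature.NumberTheory.LFunctions.WeilWindowSuzukiContinuityProofs
import HarnessLib

/-!
# HANDOFF — the UV FLOOR of the handoff capacity (cell rh-explicit, TRACK «HANDOFF», seat prove-2, ATTEMPT-14 = idea-3's hand-off P-G14-1)

HONEST FRAMING. Nothing here bears on the truth of RH: a LOWER bound on theory-2's Birman–Schwinger capacity
`ρ_q(b) = bsCapacity S_q q ⊤ b` (`Theorems/HandoffCapacity.lean`) bounds the semi-local wall `a*(S_q)` from ABOVE only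
(`le_wall_iff_bsCapacity_le_one`), and the floor below is `< 1` (`uvFloor_lt_one`): a collar pair never makes a wall by itself.
What is typed is idea-3's PART G14 lemma (`HOME/handoff/IDEAS-finite-rank.md` v2.5, deposit `handoff/idea-3/g14/`), RH-free:

for consecutive primes `q < q'`, an offset `0 < δ < 1/(2(q+1))` with `b := (log q)/2 + δ ≤ (log q')/2` and the standing
input `0 < ε(b)` (`ε = weilGroundEnergy`, the A1 ladder's certified object; under RH automatic),

  **`uvFloor q δ := w_q/(2 ε(δ) + w_q + 12 δ e^{3δ}) ≤ ρ_q(b)`**,  `w_q = 2 log q/√q`   (`uvFloor_le_bsCapacity`, `uvFloor_holds : UVFloor`).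

WITNESS (the one correction to the sketch). idea-3's test function is the antisymmetric pair `θ(x − c) − θ(−x − c)`,
`c = (log q)/2`, `θ` a near-minimiser of the tiny window `C(δ)`; its gain is `w_q·Re ∫ θ(u)·conj θ(−u) du`, which equals
`w_q‖θ‖₂²` only for EVEN `θ` (for odd `θ` it is `−w_q‖θ‖₂²`), and nothing RH-free says the tiny-window minimiser may be taken
even. The DIFFERENCE OF TRANSLATES `G = θ(· − c) − θ(· + c)` (`Theorems/HandoffTranslatePair.lean`) has gain `w_q‖θ‖₂²` for
EVERY profile and coincides with the sketch's pair when `θ` is even (`placeGain_collarPair_of_even` = the sketch's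
`CollarPairGain` in its true generality). With it: `placeGain_q(G) = w_q‖θ‖₂²` exactly and
`Re Q(G) ≤ 2 Re Q(θ) + (w_q + 8δ·M(c − δ) + 8(e^c + e^{−c})δ³)‖θ‖₂² ≤ 2 Re Q(θ) + (w_q + 12δe^{3δ})‖θ‖₂²`
(`smallTerms_le`: the sketch's constant `12 δ e^{3δ}` survives because the polar cross term has the GOOD sign; the sketch
spent `8δe^δ` on it), so for every `η > 0` the unit sphere of `C(b)` contains a test function with capacity ratio
`≥ w_q/(2(ε(δ) + η) + w_q + 12δe^{3δ})` (`exists_uvFloor_witness`), and `η → 0⁺` gives the floor (`le_of_tendsto`).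
Numerically (idea-3, MODEL/DERIVED-CHECK single-lineage, `uvfloor.py`): `ε(δ) ≈ ln coth δ − ln 4π − γ + 0.926`, floor
`0.159 (q = 5) … 0.059 (q = 59)` at the free-odd wall offsets of record — not re-derived here.

References (as printed): M. Sh. Birman / J. Schwinger (1961), the principle [folklore]; E. Bombieri, Rend. Mat. Acc. Lincei (9) 11
(2000) Thm 2, §4 Lemma 2 [`Bombieri2000Weil`]; A. Connes, C. Consani, Enseign. Math. 69 (2023) §2.2–2.4 [`ConnesConsani2023`].
The floor and its constant are this cell's (idea-3 PART G14), not in print.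
-/

set_option linter.dupNamespace false  -- the mandated namespace repeats `RiemannHypothesis`

noncomputable section

open Set Filter Complex MeasureTheory Literature.NumberTheory.LFunctions
open Summit.RiemannHypothesis.RiemannHypothesis.Theorems.Handoff
open Summit.RiemannHypothesis.RiemannHypothesis.Theorems.HandoffCapacity
open Summit.RiemannHypothesis.RiemannHypothesis.Theorems.HandoffSemilocalEnergy
open Summit.RiemannHypothesis.RiemannHypothesis.Theorems.MotivicDoor.SemilocalThreshold
open scoped Real Topology ComplexConjugate

namespace Summit.RiemannHypothesis.RiemannHypothesis.Theorems.HandoffCapacityUVFloor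

variable {q q' : ℕ} {δ : ℝ} {θ : ℝ → ℂ}

/-! ## §1 The objects (idea-3 PART G14, verbatim) -/

/-- The atom weight `w_q = 2 log q / √q` (twice the tree's `cap(q) = log q/√q`). [this track, HANDOFF-STATEMENT §D.1 / idea-3 PART G14] -/
def atomWeight (q : ℕ) : ℝ := 2 * Real.log q / Real.sqrt q

/-- The UV floor value at offset `δ`: `w_q / (2 ε(δ) + w_q + 12 δ e^{3δ})`, `ε(δ) = weilGroundEnergy δ`. [this track, idea-3 PART G14 §G14-3] -/
def uvFloor (q : ℕ) (δ : ℝ) : ℝ :=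
  atomWeight q / (2 * weilGroundEnergy δ + atomWeight q + 12 * δ * Real.exp (3 * δ))

/-- **UV floor of the handoff capacity at one prime and one offset** (idea-3 G14, hand-off P-G14-1; RH-free):
for consecutive primes `q < q'`, `0 < δ < 1/(2(q+1))`, `(log q)/2 + δ ≤ (log q')/2` and `0 < ε((log q)/2 + δ)`,
`uvFloor q δ ≤ ρ_q((log q)/2 + δ)`. [this track, idea-3 PART G14 §G14-3] -/
def UVFloorAt (q q' : ℕ) (δ : ℝ) : Prop :=
  ConsecutivePrimes q q' → 0 < δ → δ < 1 / (2 * ((q : ℝ) + 1)) →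
    Real.log q / 2 + δ ≤ Real.log q' / 2 → 0 < weilGroundEnergy (Real.log q / 2 + δ) →
    uvFloor q δ ≤ bsCapacity (Nat.primesBelow q) q (fun _ ↦ True) (Real.log q / 2 + δ)

/-- **UV floor of the handoff capacity** (all primes, all admissible offsets). [this track, idea-3 PART G14 §G14-3] -/
def UVFloor : Prop := ∀ q q' : ℕ, ∀ δ : ℝ, UVFloorAt q q' δ

/-- The floor is positive whenever `ε(δ) > 0` and `q ≥ 2`. [folklore] -/
theorem uvFloor_pos (hq : 2 ≤ q) (hδ : 0 < δ) (hε : 0 < weilGroundEnergy δ) : 0 < uvFloor q δ := by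
  unfold uvFloor atomWeight
  have hlog : 0 < Real.log q := Real.log_pos (by exact_mod_cast hq)
  have hsq : 0 < Real.sqrt q := Real.sqrt_pos.mpr (by exact_mod_cast (by omega : 0 < q))
  positivity

/-- The floor never reaches `1` (a collar pair has no `S_q`-deficit: it cannot make a wall by itself). [folklore] -/
theorem uvFloor_lt_one (hq : 2 ≤ q) (hδ : 0 < δ) (hε : 0 < weilGroundEnergy δ) : uvFloor q δ < 1 := by
  unfold uvFloor atomWeight
  have hlog : 0 < Real.log q := Real.log_pos (by exact_mod_cast hq)
  have hsq : 0 < Real.sqrt q := Real.sqrt_pos.mpr (by exact_mod_cast (by omega : 0 < q))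
  have hw : 0 < 2 * Real.log q / Real.sqrt q := by positivity
  have hextra : 0 < 12 * δ * Real.exp (3 * δ) := by positivity
  rw [div_lt_one (by positivity)]
  linarith

/-! ## §2 The small terms: `8δ·M((log q)/2 − δ) + 8(e^{c} + e^{−c})δ³ ≤ 12 δ e^{3δ}` -/

/-- `e^{(log q)/2} = √q`. [folklore] -/
theorem exp_log_half (hq : 0 < q) : Real.exp (Real.log q / 2) = Real.sqrt q := by
  have hq0 : (0 : ℝ) < q := by exact_mod_cast hq
  rw [show Real.log q / 2 = Real.log q * (1 / 2) by ring, Real.exp_mul, Real.exp_log hq0, Real.sqrt_eq_rpow]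

set_option maxHeartbeats 400000 in
/-- **The archimedean and polar cross terms fit in the sketch's constant**: for `q ≥ 2` and `0 < δ < 1/(2(q+1))`,
`8δ·archGapBound((log q)/2 − δ) + 8(e^{(log q)/2} + e^{−(log q)/2})·δ³ ≤ 12 δ e^{3δ}`
(`archGapBound((log q)/2 − δ) = e^δ q^{3/2}/(q² − e^{4δ})`; worst case `q = 2`). [this track, ATTEMPT-14 §3] -/
theorem smallTerms_le (hq : 2 ≤ q) (hδ : 0 < δ) (hδq : δ < 1 / (2 * ((q : ℝ) + 1))) :
    8 * δ * archGapBound (Real.log q / 2 - δ) +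
        8 * (Real.exp (Real.log q / 2) + Real.exp (-(Real.log q / 2))) * δ ^ 3 ≤
      12 * δ * Real.exp (3 * δ) := by
  have hq0 : (0 : ℝ) < q := by exact_mod_cast (by omega : 0 < q)
  have hq2 : (2 : ℝ) ≤ q := by exact_mod_cast hq
  -- `s = √q`
  set s : ℝ := Real.sqrt q with hs_def
  have hs0 : 0 < s := Real.sqrt_pos.2 hq0
  have hs2 : s ^ 2 = q := Real.sq_sqrt hq0.le
  have hs141 : (1.41 : ℝ) ≤ s := by nlinarith
  have hs3 : (2.8 : ℝ) ≤ s ^ 3 := by nlinarith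
  have hs4 : s ^ 4 = (q : ℝ) ^ 2 := by rw [← hs2]; ring
  have hexpc : Real.exp (Real.log q / 2) = s := exp_log_half (by omega)
  have hexpnc : Real.exp (-(Real.log q / 2)) = s⁻¹ := by rw [Real.exp_neg, hexpc]
  -- `x = e^δ ∈ [1, 6/5]`
  set x : ℝ := Real.exp δ with hx_def
  have hx0 : 0 < x := Real.exp_pos δ
  have hx1 : 1 ≤ x := Real.one_le_exp hδ.le
  have hδ6 : δ < 1 / 6 := by
    refine hδq.trans_le ?_
    rw [div_le_div_iff₀ (by positivity) (by norm_num)]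
    linarith
  have hδ1 : (q + 1 : ℝ) * δ < 1 / 2 := by
    rw [lt_div_iff₀ (by positivity)] at hδq
    linarith
  have hx65 : x ≤ 6 / 5 := by
    have h1 : -δ + 1 ≤ Real.exp (-δ) := Real.add_one_le_exp (-δ)
    rw [Real.exp_neg] at h1
    have h2 : x * (-δ + 1) ≤ 1 := by
      have := mul_le_mul_of_nonneg_left h1 hx0.le
      rwa [mul_inv_cancel₀ hx0.ne'] at this
    nlinarith [h2, mul_lt_mul_of_pos_left hδ6 hx0]
  have hx3 : Real.exp (3 * δ) = x ^ 3 := by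
    rw [show (3 : ℝ) * δ = ((3 : ℕ) : ℝ) * δ by norm_num, Real.exp_nat_mul]
  have hx4 : Real.exp (4 * δ) = x ^ 4 := by
    rw [show (4 : ℝ) * δ = ((4 : ℕ) : ℝ) * δ by norm_num, Real.exp_nat_mul]
  have hs4e : Real.exp (4 * (Real.log q / 2)) = s ^ 4 := by
    rw [show (4 : ℝ) * (Real.log q / 2) = ((4 : ℕ) : ℝ) * (Real.log q / 2) by norm_num, Real.exp_nat_mul, hexpc]
  -- the archimedean constant in closed form: `M = 1/D`, `D = (s/x)(1 − x⁴/s⁴)`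
  have hD : Real.exp (Real.log q / 2 - δ) * (1 - Real.exp (-(4 * (Real.log q / 2 - δ)))) =
      s / x * (1 - x ^ 4 / s ^ 4) := by
    rw [Real.exp_sub, hexpc, show -(4 * (Real.log q / 2 - δ)) = 4 * δ - 4 * (Real.log q / 2) by ring,
      Real.exp_sub, hx4, hs4e]
  set y : ℝ := x ^ 2 with hy_def
  have hy1 : 1 ≤ y := by rw [hy_def]; nlinarith
  have hyY : y ≤ 36 / 25 := by rw [hy_def]; nlinarith
  have hx4y : x ^ 4 = y ^ 2 := by rw [hy_def]; ring
  have hs4pos : 0 < s ^ 4 - x ^ 4 := by rw [hx4y, hs4]; nlinarith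
  have hDpos : 0 < s / x * (1 - x ^ 4 / s ^ 4) := by
    have : 0 < 1 - x ^ 4 / s ^ 4 := by
      rw [sub_pos, div_lt_one (by positivity)]; linarith
    positivity
  -- (i) `8·M ≤ (23/2)·x³`, i.e. `16 s³ ≤ 23 y (s⁴ − y²)` on `y ∈ [1, 36/25]` (concavity: the chord bounds from below)
  have hF1 : 0 ≤ 23 * (s ^ 4 - 1) - 16 * s ^ 3 := by
    nlinarith [mul_nonneg (pow_nonneg hs0.le 3) (sub_nonneg.2 hs141)]
  have hFY : 0 ≤ 23 * (36 / 25 * s ^ 4 - (36 / 25) ^ 3) - 16 * s ^ 3 := by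
    nlinarith [mul_nonneg (pow_nonneg hs0.le 3) (sub_nonneg.2 hs141)]
  have hP1 : 0 ≤ (36 / 25 - y) * (23 * (s ^ 4 - 1) - 16 * s ^ 3) := mul_nonneg (sub_nonneg.2 hyY) hF1
  have hP2 : 0 ≤ (y - 1) * (23 * (36 / 25 * s ^ 4 - (36 / 25) ^ 3) - 16 * s ^ 3) := mul_nonneg (sub_nonneg.2 hy1) hFY
  have hP3 : 0 ≤ (y - 1) * (36 / 25 - y) * (y + 61 / 25) :=
    mul_nonneg (mul_nonneg (sub_nonneg.2 hy1) (sub_nonneg.2 hyY)) (by linarith)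
  have hkey : 16 * s ^ 3 ≤ 23 * y * (s ^ 4 - y ^ 2) := by
    linear_combination (25 / 11) * hP1 + (25 / 11) * hP2 + 23 * hP3
  have hM : 8 * archGapBound (Real.log q / 2 - δ) ≤ 23 / 2 * x ^ 3 := by
    unfold archGapBound
    rw [hD, one_div, ← div_eq_mul_inv, div_le_iff₀ hDpos]
    -- `8 ≤ (23/2) x³ · (s/x)(1 − x⁴/s⁴) = (23/2) x² (s⁴ − x⁴)/s³`
    have e : 23 / 2 * x ^ 3 * (s / x * (1 - x ^ 4 / s ^ 4)) = 23 / 2 * y * (s ^ 4 - y ^ 2) / s ^ 3 := by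
      rw [hx4y, hy_def]; field_simp
    rw [e, le_div_iff₀ (by positivity)]
    linarith
  -- (ii) `8(s + 1/s)δ² ≤ 1/2 ≤ x³/2`
  have hP : 8 * (s + s⁻¹) * δ ^ 2 ≤ 1 / 2 := by
    have e : s + s⁻¹ = ((q : ℝ) + 1) / s := by
      rw [eq_div_iff hs0.ne', add_mul, inv_mul_cancel₀ hs0.ne', ← hs2]; ring
    rw [e]
    have h1 : 8 * (((q : ℝ) + 1) / s) * δ ^ 2 = 8 * δ * (((q : ℝ) + 1) * δ) / s := by ring
    rw [h1, div_le_iff₀ hs0]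
    linarith [mul_le_mul_of_nonneg_left hδ1.le (by positivity : (0 : ℝ) ≤ 8 * δ)]
  have hx3' : 1 ≤ x ^ 3 := one_le_pow₀ hx1
  -- assemble and multiply by `δ`
  rw [hexpc, hexpnc, hx3]
  have htot : 8 * archGapBound (Real.log q / 2 - δ) + 8 * (s + s⁻¹) * δ ^ 2 ≤ 12 * x ^ 3 := by linarith
  have := mul_le_mul_of_nonneg_left htot hδ.le
  linarith [this]

/-! ## §3 The witness and the floor -/

/-- **The sketch's `CollarPairGain`, in its true generality**: for an EVEN profile `θ` the antisymmetric collar pair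
`θ(x − c) − θ(−x − c)` IS the translate pair, so its gain is `w_q‖θ‖₂²` (`q` prime, `0 < δ < 1/(2(q+1))`, `tsupport θ ⊆ [−δ, δ]`);
for an ODD profile the same function is the SUM of translates and the gain is `−w_q‖θ‖₂²` (ATTEMPT-14 §1), so the sketch's
unqualified statement is false. [this track, idea-3 PART G14 (`CollarPairGain`), corrected] -/
theorem placeGain_collarPair_of_even (hq : q.Prime) (hθ : IsWeilTest θ) (hδ : 0 < δ)
    (hδq : δ < 1 / (2 * ((q : ℝ) + 1))) (hθs : tsupport θ ⊆ Icc (-δ) δ) (heven : ∀ x, θ (-x) = θ x) :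
    placeGain q (fun x ↦ θ (x - Real.log q / 2) - θ (-x - Real.log q / 2)) = atomWeight q * ∫ t : ℝ, ‖θ t‖ ^ 2 := by
  obtain ⟨-, -, hδc⟩ := translatePair_aux hq hδ hδq
  have e : (fun x ↦ θ (x - Real.log q / 2) - θ (-x - Real.log q / 2)) =
      fun x ↦ θ (x - Real.log q / 2) - θ (x + Real.log q / 2) := by
    funext x; rw [show -x - Real.log q / 2 = -(x + Real.log q / 2) by ring, heven]
  have hc0 : 0 ≤ Real.log q / 2 := by linarith
  rw [e, placeGain_eq_contribution hq (isWeilTest_translatePair hθ _) (t := Real.log q / 2 + δ) (by linarith)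
      (tsupport_translatePair_subset hθs hc0), contribution_translatePair hq hθ hδ hδq hθs, atomWeight]

/-- **The UV-floor witness** (idea-3 G14, corrected profile): on the window of the consecutive primes `q < q'`, at
`b = (log q)/2 + δ`, `0 < δ < 1/(2(q+1))`, `b ≤ (log q')/2`, `0 < ε(b)`: for every `η > 0` the unit sphere of `C(b)` contains a
test function `g` (the normalised translate pair of a near-minimiser of `C(δ)`) with
`w_q/(2(ε(δ) + η) + w_q + 12δe^{3δ}) · Re Q_{S_q ∪ {q}}(g) ≤ placeGain_q(g)`. [this track, idea-3 PART G14 §G14-3 (witness form), ATTEMPT-14] -/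
theorem exists_uvFloor_witness (h : ConsecutivePrimes q q') (hδ : 0 < δ) (hδq : δ < 1 / (2 * ((q : ℝ) + 1)))
    (hb : Real.log q / 2 + δ ≤ Real.log q' / 2) (hε : 0 < weilGroundEnergy (Real.log q / 2 + δ))
    {η : ℝ} (hη : 0 < η) :
    ∃ g : ℝ → ℂ, IsWeilTest g ∧ tsupport g ⊆ Icc (-(Real.log q / 2 + δ)) (Real.log q / 2 + δ) ∧
      ∫ t : ℝ, ‖g t‖ ^ 2 = 1 ∧ 0 < (weilSemilocalQuadratic (insert q (Nat.primesBelow q)) g).re ∧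
      atomWeight q / (2 * (weilGroundEnergy δ + η) + atomWeight q + 12 * δ * Real.exp (3 * δ)) *
          (weilSemilocalQuadratic (insert q (Nat.primesBelow q)) g).re ≤ placeGain q g := by
  have hq : q.Prime := h.1
  obtain ⟨-, -, hδc⟩ := translatePair_aux hq hδ hδq
  set c : ℝ := Real.log q / 2 with hc_def
  have hc0 : 0 < c := hδ.trans hδc
  -- a near-minimiser of the tiny window, scaled to norm `1/2`
  obtain ⟨θ, hθ, hθs, hθn, hθQ⟩ := exists_re_weilQuadratic_lt hδ hη
  set r : ℝ := (Real.sqrt 2)⁻¹ with hr_def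
  have hr0 : 0 < r := inv_pos.2 (Real.sqrt_pos.2 two_pos)
  have hr2 : r ^ 2 = 1 / 2 := by
    rw [hr_def, inv_pow, Real.sq_sqrt zero_le_two, one_div]
  set θ₂ : ℝ → ℂ := fun t ↦ (r : ℂ) * θ t with hθ₂_def
  have hθ₂ : IsWeilTest θ₂ := hθ.const_mul r
  have hθ₂s : tsupport θ₂ ⊆ Icc (-δ) δ := tsupport_mul_subset_right.trans hθs
  have hθ₂n : ∫ t : ℝ, ‖θ₂ t‖ ^ 2 = 1 / 2 := by
    simp only [hθ₂_def, norm_mul, mul_pow, Complex.norm_real, Real.norm_of_nonneg hr0.le]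
    rw [integral_const_mul, hθn, hr2, mul_one]
  have hθ₂Q : (weilQuadratic θ₂).re = 1 / 2 * (weilQuadratic θ).re := by
    rw [hθ₂_def, weilQuadratic_const_mul, Complex.normSq_ofReal, Complex.re_ofReal_mul, ← sq, hr2]
  -- the translate pair
  set G : ℝ → ℂ := fun x ↦ θ₂ (x - c) - θ₂ (x + c) with hG_def
  have hG : IsWeilTest G := isWeilTest_translatePair hθ₂ c
  have hGs : tsupport G ⊆ Icc (-(c + δ)) (c + δ) := tsupport_translatePair_subset hθ₂s hc0.le
  have hGn : ∫ t : ℝ, ‖G t‖ ^ 2 = 1 := by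
    rw [hG_def]
    simp only
    rw [integral_norm_sq_translatePair hθ₂ hθ₂s hδc, hθ₂n]
    norm_num
  have hGc : contribution q G = atomWeight q * (1 / 2) := by
    rw [hG_def, contribution_translatePair hq hθ₂ hδ hδq hθ₂s, hθ₂n, atomWeight]
  have hGQ : (weilQuadratic G).re ≤ (weilQuadratic θ).re +
      (atomWeight q + 12 * δ * Real.exp (3 * δ)) * (1 / 2) := by
    have h1 := re_weilQuadratic_translatePair_le hq hθ₂ hδ hδq hθ₂s
    rw [hθ₂n, hθ₂Q] at h1
    have h2 := smallTerms_le hq.two_le hδ hδq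
    have hw : atomWeight q = 2 * Real.log q / Real.sqrt q := rfl
    rw [hw]
    nlinarith [h1, h2]
  -- on the window the `S_q ∪ {q}`-form is Weil's form, and the place gain is the contribution
  obtain ⟨hins, -⟩ := primesBelow_consecutive h
  have hb' : c + δ ≤ Real.log (((q' - 1 : ℕ) : ℝ) + 1) / 2 := by rw [h.cast_pred_add_one]; exact hb
  have hfull : (weilSemilocalQuadratic (insert q (Nat.primesBelow q)) G).re = (weilQuadratic G).re := by
    rw [← hins, h.primesBelow_eq, weilSemilocalQuadratic_eq_weilQuadratic_of_forall hG
      (primeFactors_subset_primesBelow_succ_of_gap h.gap) (hGs.trans (Icc_subset_Icc (neg_le_neg hb') hb'))]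
  have hpg : placeGain q G = contribution q G :=
    placeGain_eq_contribution hq hG (t := c + δ) (by linarith) hGs
  have hQpos : 0 < (weilQuadratic G).re :=
    hε.trans_le (weilGroundEnergy_le_re_weilQuadratic hG hGs hGn)
  refine ⟨G, hG, hGs, hGn, by rwa [hfull], ?_⟩
  rw [hfull, hpg, hGc]
  have hw0 : 0 < atomWeight q := by
    unfold atomWeight
    have hlog : 0 < Real.log q := Real.log_pos (by exact_mod_cast hq.one_lt)
    have hsq : 0 < Real.sqrt q := Real.sqrt_pos.mpr (by exact_mod_cast hq.pos)
    positivity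
  have hT : 0 ≤ 12 * δ * Real.exp (3 * δ) := by positivity
  have hεδ : 0 < weilGroundEnergy δ := hε.trans_le (weilGroundEnergy_anti hδ (by linarith))
  have hDpos : 0 < 2 * (weilGroundEnergy δ + η) + atomWeight q + 12 * δ * Real.exp (3 * δ) := by positivity
  rw [div_mul_eq_mul_div, div_le_iff₀ hDpos]
  nlinarith [hGQ, hθQ, hQpos, hw0]

/-- **THE UV FLOOR** (idea-3 PART G14, P-G14-1): `uvFloor q δ ≤ ρ_q((log q)/2 + δ)` for consecutive primes `q < q'`,
`0 < δ < 1/(2(q+1))`, `(log q)/2 + δ ≤ (log q')/2`, `0 < ε((log q)/2 + δ)`. [this track, idea-3 PART G14 §G14-3; proof ATTEMPT-14] -/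
theorem uvFloor_le_bsCapacity (h : ConsecutivePrimes q q') (hδ : 0 < δ) (hδq : δ < 1 / (2 * ((q : ℝ) + 1)))
    (hb : Real.log q / 2 + δ ≤ Real.log q' / 2) (hε : 0 < weilGroundEnergy (Real.log q / 2 + δ)) :
    uvFloor q δ ≤ bsCapacity (Nat.primesBelow q) q (fun _ ↦ True) (Real.log q / 2 + δ) := by
  have hq : q.Prime := h.1
  set b : ℝ := Real.log q / 2 + δ with hb_def
  have hpos : 0 < semilocalGroundEnergy (insert q (Nat.primesBelow q)) (fun _ ↦ True) b := by
    rwa [semilocalGroundEnergy_insert_window h hb]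
  set w : ℝ := atomWeight q with hw_def
  set T : ℝ := 12 * δ * Real.exp (3 * δ) with hT_def
  set E : ℝ := weilGroundEnergy δ with hE_def
  have hw0 : 0 < w := by
    rw [hw_def]; unfold atomWeight
    have hlog : 0 < Real.log q := Real.log_pos (by exact_mod_cast hq.one_lt)
    have hsq : 0 < Real.sqrt q := Real.sqrt_pos.mpr (by exact_mod_cast hq.pos)
    positivity
  have hlog0 : 0 ≤ Real.log q := Real.log_nonneg (by exact_mod_cast hq.one_lt.le)
  have hεδ : 0 < E := hε.trans_le (weilGroundEnergy_anti hδ (by rw [hb_def]; linarith))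
  have hT0 : 0 ≤ T := by rw [hT_def]; positivity
  have hD : 0 < 2 * E + w + T := by positivity
  -- every `η > 0` gives a sphere element of ratio `≥ w/(2(E + η) + w + T)`
  have key : ∀ η : ℝ, 0 < η → w / (2 * (E + η) + w + T) ≤ bsCapacity (Nat.primesBelow q) q (fun _ ↦ True) b := by
    intro η hη
    obtain ⟨g, hg, hgs, hgn, hgpos, hineq⟩ := exists_uvFloor_witness h hδ hδq hb hε hη
    refine le_trans ?_ (div_le_bsCapacity hpos hg hgs trivial hgn)
    rwa [le_div_iff₀ hgpos]
  -- let `η → 0⁺`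
  have hcont : ContinuousAt (fun η : ℝ ↦ w / (2 * (E + η) + w + T)) 0 :=
    continuousAt_const.div (by fun_prop) (by simp only [add_zero]; exact hD.ne')
  have ht : Tendsto (fun η : ℝ ↦ w / (2 * (E + η) + w + T)) (𝓝[>] 0) (𝓝 (w / (2 * E + w + T))) := by
    have := hcont.tendsto
    simp only [add_zero] at this
    exact this.mono_left nhdsWithin_le_nhds
  have hev : ∀ᶠ η in 𝓝[>] (0 : ℝ), w / (2 * (E + η) + w + T) ≤ bsCapacity (Nat.primesBelow q) q (fun _ ↦ True) b :=
    eventually_nhdsWithin_of_forall fun η hη ↦ key η hη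
  have hlim := le_of_tendsto ht hev
  show uvFloor q δ ≤ _
  unfold uvFloor
  rw [← hw_def, ← hE_def, ← hT_def]
  exact hlim

/-- `UVFloorAt q q' δ` for every `q, q', δ`. [this track, idea-3 PART G14 §G14-3] -/
theorem uvFloorAt_holds (q q' : ℕ) (δ : ℝ) : UVFloorAt q q' δ :=
  fun h hδ hδq hb hε ↦ uvFloor_le_bsCapacity h hδ hδq hb hε

/-- **`UVFloor` holds.** [this track, idea-3 PART G14 §G14-3] -/
theorem uvFloor_holds : UVFloor := uvFloorAt_holds

/-- In wall language (theory-2's unit-level-set criterion, `le_wall_iff_bsCapacity_le_one`): on the handoff window, wherever the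
semi-local wall has not yet been passed (`b ≤ a*(S_q)`) the floor is at most `1` — consistent (`uvFloor_lt_one`) and silent on RH;
recorded only to pin the direction of the information. [this track, idea-3 PART G14 §G14-5] -/
theorem uvFloor_le_one_of_le_wall (h : ConsecutivePrimes q q') (hδ : 0 < δ) (hδq : δ < 1 / (2 * ((q : ℝ) + 1)))
    (hb : Real.log q / 2 + δ ≤ Real.log q' / 2) (hε : 0 < weilGroundEnergy (Real.log q / 2 + δ))
    (hwall : Real.log q / 2 + δ ≤ weilSemilocalThreshold (Nat.primesBelow q)) : uvFloor q δ ≤ 1 :=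
  (uvFloor_le_bsCapacity h hδ hδq hb hε).trans
    ((le_wall_iff_bsCapacity_le_one h (by linarith [(translatePair_aux h.1 hδ hδq).2.2]) hb hε).1 hwall)

end Summit.RiemannHypothesis.RiemannHypothesis.Theorems.HandoffCapacityUVFloor

end
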